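import Summits.HubbardSuperconductivity.HubbardSuperconductivity.Theorems.CooperPairDMottWalkCooperPairDMottPairTrialCeilingCore

/-!
# Route `CooperPairDMottWalk`, crux `CooperPairDMott` (stmt-HubbardSuperconductivity-1177):
# stub P `stub_pairTrialCeiling` — the one-plaquette pair as a trial state, GIVEN the plaquette GC window

Support file for the registered line `Cruxes/CooperPairDMott/Lines/birth.lean`. The stub asserts, for the
breathing torus `H_L(1, b, U) = hamiltonian (G_L \ ⊤.comap plaq) 1 U + hamiltonian (G_L ⊓ ⊤.comap plaq) b 0`
(`L = 4k + 4`, `E(N, M) = minEnergyOn (szSector N M)`), the two-hole ceiling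
`E(L² − 2, 0) ≤ E(L², 0) + (e₂⁰(U) − e₄⁰(U)) + C·b`, uniformly in `L`, for all `U ∈ [2, 4]` and small `b`.
`pairTrialCeiling_of_plaquetteGCWindow` PROVES it (conclusion = the stub verbatim) from ONE hypothesis on
the isolated plaquette `h = hubbardTorus 2 2 1 U`, `U ∈ [2, 4]`: there are `μ` and `γ > 0` with
`Re⟨v, (h − μN) v⟩ ≥ (e₄ − 4μ + γ)‖v‖²` for every `v` orthogonal to the `(4, 0)` ground space
`W = {w ∈ szSector 4 0 | h w = e₄ w}` — the 4-electron singlet ground space of one plaquette is its gapped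
GRAND-CANONICAL ground space at chemical potential `μ` (numerically `μ = U/2`, `γ = 0.14 … 0.30` on
`[2, 4]`, the singlet–triplet gap of the plaquette). This 256-dimensional spectral fact is the companion of
the route's certified plaquette item `PlaquettePairBinding` (stmt-HubbardSuperconductivity-1181); it is NOT
proved here, so the stub stays open and this file lands with `--supports`. The estimate itself is
`pairTrialCeiling_core` (file `…PairTrialCeilingCore`), fed with the plaquette data of `plaquette_frame`,
`plaquette_pair` (file `…PairTrialCeilingPlaquetteData`); here only the constants are chosen:
`C = 144√(2 dim W) + 1`, `b₀ = min(γ/128, 1)`, `k₀ = 0`, and `L² = 2p`, `L² − 2 = 2(p − 1)` for `L = 4k + 4`.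

References: W.-F. Tsai, S. A. Kivelson, PRB 73 (2006) 214510 [TsaiKivelson2006]; E. Altman, A. Auerbach,
PRB 65 (2002) 104508 §II.D. All statements are [folklore]. No definition is introduced.
-/

set_option linter.dupNamespace false

noncomputable section

namespace Summit.HubbardSuperconductivity.HubbardSuperconductivity.Theorems.CooperPairDMottWalk

open Matrix Finset Literature.MathematicalPhysics.QuantumLattice Literature.Probability.LatticeModels
open Literature.MathematicalPhysics.QuantumLattice.ThermodynamicLimit (norm_toLp_sq norm_toLp_mulVec_le star_dotProduct_self_eq_re)
open Summit.HubbardSuperconductivity.HubbardSuperconductivity.Theses.CooperPairDMottWalk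
open scoped ComplexOrder Matrix.Norms.L2Operator

/-! ### The pair ceiling, given the plaquette grand-canonical window -/

/-- **Stub P (`stub_pairTrialCeiling`) GIVEN the plaquette grand-canonical window.** If for every
`U ∈ [2, 4]` there are `μ` and `γ > 0` such that `h − μN ≥ e₄ − 4μ + γ` (as a form) on the orthogonal
complement of the `(4, 0)` ground space of the plaquette `h = hubbardTorus 2 2 1 U` (`e₄` its `(4,0)`
sector energy) — i.e. the 4-electron singlet ground space is the gapped grand-canonical ground space of
one plaquette at chemical potential `μ` — then the two-hole level of the breathing torus `H_L(1, b, U)`,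
`L = 4k + 4`, obeys `E(L² − 2, 0) ≤ E(L², 0) + (e₂ − e₄) + C·b` for all `b ∈ (0, b₀)`, with
`C = 144 √(2 dim W) + 1`, `b₀ = min(γ/128, 1)`, `k₀ = 0` (trial state `(f_c)_*|π⟩⟨σ| Ω` on the best
plaquette `c` of the dressed parent `Ω`; the exact commutator `[h, |π⟩⟨σ|] = (e₂ − e₄)|π⟩⟨σ|`, graded
locality, and the best-plaquette averaging through the local gap `γ`). The window hypothesis is a
256-dimensional spectral fact about one plaquette (numerically `μ = U/2`, `γ ≈ 0.14–0.30` on `[2,4]`);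
it is the part of the route's plaquette data not yet certified in the tree. [folklore] -/
theorem pairTrialCeiling_of_plaquetteGCWindow
    (hGC : ∀ U ∈ Set.Icc (2 : ℝ) 4, ∃ μ γ : ℝ, 0 < γ ∧
      ∀ v : Fock (Orb (FermionTorus 2 2)),
        (∀ w ∈ szSector (Λ := FermionTorus 2 2) 4 0,
          hubbardTorus 2 2 1 U *ᵥ w = (((hubbardTorus 2 2 1 U).minEnergyOn (szSector 4 0) : ℝ) : ℂ) • w →
            star w ⬝ᵥ v = 0) →
        ((hubbardTorus 2 2 1 U).minEnergyOn (szSector 4 0) - 4 * μ + γ) * (star v ⬝ᵥ v).re ≤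
          (star v ⬝ᵥ ((hubbardTorus 2 2 1 U - (μ : ℂ) • totalNumber) *ᵥ v)).re) :
    (let Hb := fun (L : ℕ) (a b U : ℝ) => hamiltonian (fermionTorusGraph 2 L \ (⊤ : SimpleGraph (Fin 2 → ℕ)).comap (fun (x : FermionTorus 2 L) (i : Fin 2) => (ofLex x i : ℕ) / 2)) a U + hamiltonian (fermionTorusGraph 2 L ⊓ (⊤ : SimpleGraph (Fin 2 → ℕ)).comap (fun (x : FermionTorus 2 L) (i : Fin 2) => (ofLex x i : ℕ) / 2)) b 0;
    ∀ U ∈ Set.Icc (2 : ℝ) 4, ∃ C > (0 : ℝ), ∃ b₀ > (0 : ℝ), ∀ b ∈ Set.Ioo 0 b₀, ∃ k₀ : ℕ, ∀ k ≥ k₀,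
      (Hb (4 * k + 4) 1 b U).minEnergyOn (szSector ((4 * k + 4) ^ 2 - 2) 0) ≤
        (Hb (4 * k + 4) 1 b U).minEnergyOn (szSector ((4 * k + 4) ^ 2) 0) +
          ((hubbardTorus 2 2 1 U).minEnergyOn (szSector 2 0) -
            (hubbardTorus 2 2 1 U).minEnergyOn (szSector 4 0)) + C * b) := by
  dsimp only
  intro U hU
  obtain ⟨μ, γ, hγ, hgap⟩ := hGC U hU
  obtain ⟨k, B, hk, hBB, hB, hdefect⟩ := plaquette_frame U hgap
  obtain ⟨π, hπ1, hπS, hπE⟩ := plaquette_pair U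
  refine ⟨144 * Real.sqrt (2 * k) + 1, by positivity, min (γ / 128) 1, by positivity, ?_⟩
  intro b hb
  refine ⟨0, fun k' _ => ?_⟩
  have hb0 : 0 < b := hb.1
  have hbγ : b ≤ γ / 128 := (le_of_lt hb.2).trans (min_le_left _ _)
  set L := 4 * k' + 4 with hL
  haveI : NeZero L := ⟨by omega⟩
  have hLeven : Even L := ⟨2 * k' + 2, by omega⟩
  have hL4 : 4 ≤ L := by omega
  set p := 8 * (k' + 1) ^ 2 with hp
  have hp1 : 1 ≤ p := by
    have : 1 ≤ (k' + 1) ^ 2 := Nat.one_le_pow _ _ (by omega)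
    omega
  have hLp : L ^ 2 = 2 * p := by rw [hL, hp]; ring
  have hL2 : L ^ 2 - 2 = 2 * (p - 1) := by omega
  rw [hL2, hLp]
  have hcore := pairTrialCeiling_core hLeven hL4 U μ γ b hγ hb0 hbγ hk hBB hB hdefect hπ1 hπS hπE hLp
  nlinarith [hcore, hb0]


/-! ### Registered form -/

/-- **Registered sub-goal `pairTrialCeiling_conditional`** (closed form without `let`, as registered on
the crux item): the plaquette grand-canonical window implies stub P with the breathing Hamiltonian
written out at `L = 4k + 4`. [folklore] -/
theorem pairTrialCeiling_conditional : (∀ U ∈ Set.Icc (2 : ℝ) 4, ∃ μ γ : ℝ, 0 < γ ∧ ∀ v : Fock (Orb (FermionTorus 2 2)), (∀ w ∈ szSector (Λ := FermionTorus 2 2) 4 0, hubbardTorus 2 2 1 U *ᵥ w = (((hubbardTorus 2 2 1 U).minEnergyOn (szSector 4 0) : ℝ) : ℂ) • w → star w ⬝ᵥ v = 0) → ((hubbardTorus 2 2 1 U).minEnergyOn (szSector 4 0) - 4 * μ + γ) * (star v ⬝ᵥ v).re ≤ (star v ⬝ᵥ ((hubbardTorus 2 2 1 U - (μ : ℂ)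 • totalNumber) *ᵥ v)).re) → ∀ U ∈ Set.Icc (2 : ℝ) 4, ∃ C > (0 : ℝ), ∃ b₀ > (0 : ℝ), ∀ b ∈ Set.Ioo 0 b₀, ∃ k₀ : ℕ, ∀ k ≥ k₀, (hamiltonian (fermionTorusGraph 2 (4 * k + 4) \ (⊤ : SimpleGraph (Fin 2 → ℕ)).comap (fun (x : FermionTorus 2 (4 * k + 4)) (i : Fin 2) => (ofLex x i : ℕ) / 2)) 1 U + hamiltonian (fermionTorusGraph 2 (4 * k + 4) ⊓ (⊤ : SimpleGraph (Fin 2 → ℕ)).comap (fun (x : FermionTorus 2 (4 * k + 4)) (i : Fin 2) => (ofLex x i : ℕ) / 2)) b 0).minEnergyOn (szSector ((4 * k + 4) ^ 2 - 2) 0) ≤ (hamiltonian (fermionTorusGraph 2 (4 * k + 4) \ (⊤ : SimpleGraph (Fin 2 → ℕ)).comap (fun (x : FermionTorus 2 (4 * k + 4)) (i : Fin 2) => (ofLex x i : ℕ) / 2)) 1 U + hamiltonian (fermionTorusGraph 2 (4 * k + 4) ⊓ (⊤ : SimpleGraph (Fin 2 → ℕ)).comap (fun (x : FermionTorus 2 (4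 * k + 4)) (i : Fin 2) => (ofLex x i : ℕ) / 2)) b 0).minEnergyOn (szSector ((4 * k + 4) ^ 2) 0) + ((hubbardTorus 2 2 1 U).minEnergyOn (szSector 2 0) - (hubbardTorus 2 2 1 U).minEnergyOn (szSector 4 0)) + C * b := by
  intro hGC
  have h := pairTrialCeiling_of_plaquetteGCWindow hGC
  dsimp only at h
  exact h

end Summit.HubbardSuperconductivity.HubbardSuperconductivity.Theorems.CooperPairDMottWalk

end
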